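import Literature.MathematicalPhysics.QuantumFieldTheory.BalabanImbrieJaffe1984to88.BIJ88PolymerRep5134
import Literature.MathematicalPhysics.QuantumFieldTheory.BalabanImbrieJaffe1984to88.BIJ88FTCExpansion305

/-!
# `BalabanImbrieJaffe1984to88.BIJ88PolymerRep5134Deriv` — T. Bałaban, J. Imbrie, A. Jaffe, *Effective action and cluster properties of the
abelian Higgs model*, Commun. Math. Phys. **114** (1988) 257–315 [BalabanImbrieJaffe1988], §5.13 pp. 305–306 [PDF 49–50]: **the printed
DERIVATIVE FORM of the activities** — `g₁(X) = Σ_{Γ: X single cluster} ∫ds_Γ (∂/∂s_Γ)⟨Π_{□_i⊂X} f(□_i)⟩_{s_Γ,X}` — **equals the corner form** of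
`BIJ88PolymerRep5134.g1` under the smoothness hypotheses of the p. 305 FTC expansion (p02's `BIJ88FTCExpansion305.ftc_expansion`), and
**display (5.13.4) (left equality) with the printed activities** follows (`polymerRep_deriv`).

statement-level skeleton of published theorems with citation tags; proofs where landed; nothing here is a claim about the Yang–Mills mass gap

PDF held: `paper:balaban1988-cmp114-bij-abelian-higgs-effective-action` (journal page = PDF page + 256); pp. 305–306 = PDF 49–50 read as images
this session (p25 seat renders).

**The print (verbatim).** p. 305: *"⟨Π_{i∈I} f(□_i)⟩_1 = Σ_{Γ⊂I} ∫ds_Γ (∂/∂s_Γ)⟨Π_{i∈I} f(□_i)⟩_{s_Γ}. Here s_Γ specifies s_i = 0 for i ∉ Γ,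
ds_Γ = Π_{i∈Γ} ds_i, ∂/∂s_Γ = Π_{i∈Γ} d/ds_i"*; p. 306: *"Given some region X, a union of □_i, we sum Γ over all subsets of {i ∈ I: □_i ⊂ X}, such
that X is a single cluster. … g₁(X) = Σ_Γ ∫ds_Γ Σ_{π∈𝒫(Γ)} ⟨…⟩_{s_Γ,X}."*

**What is proved (0 `sorry`, standard axioms, 0 new `Prop` facts).** For a duplicate-free master list `L` of coordinates and a family
`D Γ` (`D ∅ = F`, `D (insert k Γ) = ∂_k D Γ`, continuous — p02's hypotheses verbatim):
* §1 `filter_mem_toFinset_eq_of_sublist`, `toFinset_filter_mem`, **`expansionSum_filter_eq_sum_powerset`** (p02's `expansionSum` over the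
  sublists of `L|_Γ` IS the sum over `Γ′ ⊆ Γ` of `∫ds_{Γ′} D_{Γ′}`, the iterated `∫₀¹` in the order of `L`).
* §2 `onePt_filter`; **`iterInt_eq_cornerSum`**: `∫ds_Γ (∂/∂s_Γ)F|_{s=0 off Γ} = Σ_{Λ⊆Γ} (−1)^{|Γ∖Λ|} F(1_Λ)` — `ftc_expansion` on every sub-box and
  Möbius inversion (`BIJ88Clusters5134.cornerSum_eq_of_forall_sum`).
* §3 `g1Deriv adj L D X` — THE PRINTED `g₁(X)` (derivative form, sum over `Γ ⊆ X` with `clusters(X,Γ) = {X}`); **`g1Deriv_eq_g1`** (= the corner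
  form for `z X Λ := D X ∅ (1_Λ)`); **`polymerRep_deriv`**: if every sub-region `X ⊆ W` carries such a family `D X` and the corner values are
  cluster-factorizing (`IsClusterFactorizing`, p. 306 — Gaussian instance `BIJ88PolymerRep5134Gauss`), then
  `⟨Π_{i∈W}f(□_i)⟩_{1_W,W} = Σ_{P admissible filling of W} Π_{X∈P} g1Deriv X` — display (5.13.4), left equality, activities as printed.

**Honest scope.** The smoothness data (`D X`, all mixed `s`-partials of `s ↦ ⟨Π f(□_i)⟩_{s,X}`, continuous, differentiable along coordinate
lines at every `s ∈ ℝ^I` — p02's global hypotheses) are HYPOTHESES here; for the Gaussian integrals of §5.13 only the first derivative at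
`s ∈ [0,1]^I` is in the tree (p13 `BIJ88SDerivative305.hasDerivAt_expectation_interp`). The walk evaluation (5.13.3) of `∂/∂s_Γ⟨…⟩` is not
modelled. NOT summit progress; NOT continuum; NOT Clay. Imports: `BIJ88PolymerRep5134`, `BIJ88FTCExpansion305`; modifies nothing. Cell
`lit-balaban` Phase 2, seat p25 gen 8; row C2.Eq5.13.3-5.13.4 (owner r16, referee ref-5).
-/

noncomputable section

namespace Literature.MathematicalPhysics.QuantumFieldTheory.BalabanImbrieJaffe1984to88.BIJ88PolymerRep5134Deriv

open Finset Function
open Literature.Probability.LatticeModels (IsSetPartition setPartitions mem_setPartitions)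
open Literature.MathematicalPhysics.QuantumFieldTheory.BalabanImbrieJaffe1984to88.BIJ88FTCExpansion305
  (iterInt expansionSum onePt ftc_expansion)
open BIJ88Clusters5134 BIJ88PolymerRep5134

variable {ι : Type*} [DecidableEq ι]

/-! ## §1 Sublists of a duplicate-free coordinate list are its filters by subsets -/

/-- a sublist of a duplicate-free list is the filter of the list by its own elements. [cite: BalabanImbrieJaffe1988, (5.13.3) p.305] -/
theorem filter_mem_toFinset_eq_of_sublist {l Γ : List ι} (h : Γ.Sublist l) : l.Nodup → l.filter (· ∈ Γ.toFinset) = Γ := by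
  induction h with
  | slnil => intro; rfl
  | @cons Γ l a h ih =>
      intro hl
      have hal : a ∉ l := (List.nodup_cons.1 hl).1
      have haΓ : a ∉ Γ := fun ha => hal (h.subset ha)
      rw [List.filter_cons_of_neg (by simpa using haΓ)]
      exact ih (List.nodup_cons.1 hl).2
  | @cons_cons Γ l a h ih =>
      intro hl
      have hal : a ∉ l := (List.nodup_cons.1 hl).1
      rw [List.filter_cons_of_pos (by simp)]
      congr 1
      have hcongr : l.filter (· ∈ (a :: Γ).toFinset) = l.filter (· ∈ Γ.toFinset) := by
        refine List.filter_congr fun x hx => ?_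
        have hxa : x ≠ a := fun e => hal (e ▸ hx)
        simp [hxa]
      rw [hcongr]
      exact ih (List.nodup_cons.1 hl).2

/-- the elements of a filter by a subset. [cite: BalabanImbrieJaffe1988, (5.13.3) p.305] -/
theorem toFinset_filter_mem {l : List ι} {Γ : Finset ι} (hΓ : Γ ⊆ l.toFinset) : (l.filter (· ∈ Γ)).toFinset = Γ := by
  ext x
  simp only [List.mem_toFinset, List.mem_filter, decide_eq_true_eq]
  constructor
  · rintro ⟨-, hx⟩
    exact hx
  · intro hx
    exact ⟨List.mem_toFinset.1 (hΓ hx), hx⟩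

/-- **the printed sum over `Γ′ ⊂ Γ` as a sum over the powerset**: for a duplicate-free master list `L` and `Γ ⊆ L`, p02's
`expansionSum (L.filter (· ∈ Γ)) D σ = Σ_{Γ′ ⊆ Γ} ∫ds_{Γ′} D_{Γ′}` with `∫ds_{Γ′}` taken in the coordinate order of `L`.
[cite: BalabanImbrieJaffe1988, (5.13.3) p.305] -/
theorem expansionSum_filter_eq_sum_powerset {L : List ι} (hL : L.Nodup) (D : Finset ι → (ι → ℝ) → ℝ) (σ : ι → ℝ)
    {Γ : Finset ι} (hΓ : Γ ⊆ L.toFinset) :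
    expansionSum (L.filter (· ∈ Γ)) D σ = ∑ Γ' ∈ Γ.powerset, iterInt (L.filter (· ∈ Γ')) (D Γ') σ := by
  set l := L.filter (· ∈ Γ) with hl
  have hln : l.Nodup := hL.filter _
  have hlΓ : l.toFinset = Γ := toFinset_filter_mem hΓ
  have hlL : l.Sublist L := List.filter_sublist
  rw [expansionSum, ← List.sum_toFinset _ (List.nodup_sublists'.2 hln)]
  refine sum_nbij' (fun Γ'' => Γ''.toFinset) (fun Γ' => l.filter (· ∈ Γ')) ?_ ?_ ?_ ?_ ?_
  · intro Γ'' hΓ''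
    have hsub : Γ''.Sublist l := List.mem_sublists'.1 (List.mem_toFinset.1 hΓ'')
    rw [mem_powerset, ← hlΓ]
    intro x hx
    exact List.mem_toFinset.2 (hsub.subset (List.mem_toFinset.1 hx))
  · intro Γ' _
    exact List.mem_toFinset.2 (List.mem_sublists'.2 List.filter_sublist)
  · intro Γ'' hΓ''
    have hsub : Γ''.Sublist l := List.mem_sublists'.1 (List.mem_toFinset.1 hΓ'')
    exact filter_mem_toFinset_eq_of_sublist hsub hln
  · intro Γ' hΓ'
    exact toFinset_filter_mem (hlΓ.symm ▸ mem_powerset.1 hΓ')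
  · intro Γ'' hΓ''
    have hsub : Γ''.Sublist l := List.mem_sublists'.1 (List.mem_toFinset.1 hΓ'')
    show iterInt Γ'' (D Γ''.toFinset) σ = iterInt (L.filter (· ∈ Γ''.toFinset)) (D Γ''.toFinset) σ
    rw [filter_mem_toFinset_eq_of_sublist (hsub.trans hlL) hL]

/-! ## §2 The printed term `∫ds_Γ ∂_Γ F|_{s=0 off Γ}` IS the corner sum `Σ_{Λ⊆Γ}(−1)^{|Γ∖Λ|}F(1_Λ)` -/

/-- the evaluation point `onePt` of p02 for the filtered list is the corner `1_Γ`. [cite: BalabanImbrieJaffe1988, (5.13.3) p.305] -/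
theorem onePt_filter {L : List ι} {Γ : Finset ι} (hΓ : Γ ⊆ L.toFinset) : onePt (L.filter (· ∈ Γ)) 0 = corner ℝ Γ := by
  funext i
  simp only [onePt, corner, List.mem_filter, decide_eq_true_eq, Pi.zero_apply]
  by_cases hi : i ∈ Γ
  · simp [hi, List.mem_toFinset.1 (hΓ hi)]
  · simp [hi]

/-- **`∫ds_Γ (∂/∂s_Γ)F|_{s_i=0, i∉Γ} = Σ_{Λ⊆Γ} (−1)^{|Γ∖Λ|} F(1_Λ)`** (p. 305): for a function `F = D ∅` of the parameters with continuous
mixed partials `D Γ = ∂_ΓF` along the coordinates of a duplicate-free list `L` (the hypotheses of p02's `BIJ88FTCExpansion305.ftc_expansion`,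
which is that identity summed over `Γ`), each individual term is the alternating sum of the corner values — by `ftc_expansion` on every
sub-box `[0,1]^Γ` and Möbius inversion (`BIJ88Clusters5134.cornerSum_eq_of_forall_sum`). [cite: BalabanImbrieJaffe1988, (5.13.3) p.305] -/
theorem iterInt_eq_cornerSum {L : List ι} (hL : L.Nodup) (D : Finset ι → (ι → ℝ) → ℝ) (hcont : ∀ Γ, Continuous (D Γ))
    (hderiv : ∀ (Γ : Finset ι) (k : ι), k ∈ L → k ∉ Γ → ∀ s : ι → ℝ,
      HasDerivAt (fun u => D Γ (update s k u)) (D (insert k Γ) s) (s k))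
    {Γ : Finset ι} (hΓ : Γ ⊆ L.toFinset) :
    iterInt (L.filter (· ∈ Γ)) (D Γ) 0 = cornerSum (fun Λ => D ∅ (corner ℝ Λ)) Γ := by
  symm
  refine cornerSum_eq_of_forall_sum (R := ℝ) (F := fun Λ => D ∅ (corner ℝ Λ))
    (J := fun Γ' => iterInt (L.filter (· ∈ Γ')) (D Γ') 0) (W := L.toFinset) ?_ Γ hΓ
  intro Γ' hΓ'
  have h := ftc_expansion (L.filter (· ∈ Γ')) (hL.filter _) D 0 hcont
    (fun Γ'' k hk hkΓ s => hderiv Γ'' k (List.mem_of_mem_filter hk) hkΓ s) (fun _ _ => rfl)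
  rw [onePt_filter hΓ', expansionSum_filter_eq_sum_powerset hL D 0 hΓ'] at h
  exact h

/-! ## §3 The printed activities in derivative form, and display (5.13.4) with them -/

section PrintedActivities

variable (adj : ι → ι → Prop) [DecidableRel adj]

/-- **the printed `g₁(X)` in derivative form** (p. 306 [PDF 50]): `g₁(X) = Σ_{Γ⊆X: X is a single cluster of Γ} ∫ds_Γ (∂/∂s_Γ)⟨Π_{□_i⊂X}
f(□_i)⟩_{s_Γ,X}` — here for a family `D X Γ` (`D X Γ = ∂_Γ` of `s ↦ ⟨Π_{□_i⊂X} f(□_i)⟩_{s,X}`, `D X ∅` the expectation itself), the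
integrals `∫ds_Γ` taken as p02's iterated `∫₀¹` in the coordinate order of a master list `L` (the displayed walk expansion of the derivative,
(5.13.3), is not reproduced). [cite: BalabanImbrieJaffe1988, p.306 (Sect. 5.13)] -/
def g1Deriv (L : List ι) (D : Finset ι → Finset ι → (ι → ℝ) → ℝ) (X : Finset ι) : ℝ :=
  ∑ Γ ∈ X.powerset with clusters adj X Γ = {X}, iterInt (L.filter (· ∈ Γ)) (D X Γ) 0

/-- **derivative form = corner form**: under the smoothness hypotheses of the FTC expansion for the region `X`, the printed `g₁(X)` equals
the corner-form `g1` of `BIJ88PolymerRep5134` for the corner expectations `z X Λ := D X ∅ (1_Λ)`. [cite: BalabanImbrieJaffe1988, p.306 (Sect. 5.13)] -/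
theorem g1Deriv_eq_g1 {L : List ι} (hL : L.Nodup) (D : Finset ι → Finset ι → (ι → ℝ) → ℝ) {X : Finset ι} (hX : X ⊆ L.toFinset)
    (hcont : ∀ Γ, Continuous (D X Γ))
    (hderiv : ∀ (Γ : Finset ι) (k : ι), k ∈ L → k ∉ Γ → ∀ s : ι → ℝ,
      HasDerivAt (fun u => D X Γ (update s k u)) (D X (insert k Γ) s) (s k)) :
    g1Deriv adj L D X = g1 adj (fun Y Λ => D Y ∅ (corner ℝ Λ)) X := by
  refine sum_congr rfl fun Γ hΓ => ?_
  exact iterInt_eq_cornerSum hL (D X) hcont hderiv ((mem_powerset.1 (mem_filter.1 hΓ).1).trans hX)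

/-- **DISPLAY (5.13.4), LEFT EQUALITY, WITH THE PRINTED DERIVATIVE-FORM ACTIVITIES**: if for every sub-region `X ⊆ W` the expectation
`s ↦ ⟨Π_{□_i⊂X} f(□_i)⟩_{s,X}` comes with continuous mixed partials along the coordinates (p02's FTC hypotheses: the family `D X`) and its corner
values `z X Λ = ⟨Π_{□_i⊂X}f(□_i)⟩_{1_Λ,X}` are cluster-factorizing (p. 306 factorization; Gaussian instance `BIJ88PolymerRep5134Gauss`), then
`⟨Π_{i∈W} f(□_i)⟩_{1_W,W} = Σ_{{X_α} admissible filling of W} Π_α g₁(X_α)` with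
`g₁(X) = Σ_{Γ⊆X: X single cluster} ∫ds_Γ (∂/∂s_Γ)⟨Π_{□_i⊂X} f(□_i)⟩_{s_Γ,X}` as printed. [cite: BalabanImbrieJaffe1988, (5.13.4) p.306] -/
theorem polymerRep_deriv {L : List ι} (hL : L.Nodup) (D : Finset ι → Finset ι → (ι → ℝ) → ℝ) {W : Finset ι} (hW : W ⊆ L.toFinset)
    (hcont : ∀ X ⊆ W, ∀ Γ, Continuous (D X Γ))
    (hderiv : ∀ X ⊆ W, ∀ (Γ : Finset ι) (k : ι), k ∈ L → k ∉ Γ → ∀ s : ι → ℝ,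
      HasDerivAt (fun u => D X Γ (update s k u)) (D X (insert k Γ) s) (s k))
    (hz : IsClusterFactorizing adj (fun X Λ => D X ∅ (corner ℝ Λ))) :
    D W ∅ (corner ℝ W) = ∑ P ∈ (setPartitions W).filter (IsAdmissible adj), ∏ X ∈ P, g1Deriv adj L D X := by
  have h : D W ∅ (corner ℝ W)
      = ∑ P ∈ (setPartitions W).filter (IsAdmissible adj), ∏ X ∈ P, g1 adj (fun Y Λ => D Y ∅ (corner ℝ Λ)) X :=
    polymerRep hz W
  rw [h]
  refine sum_congr rfl fun P hP => prod_congr rfl fun X hXP => ?_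
  have hPp : IsSetPartition W P := mem_setPartitions.1 (mem_filter.1 hP).1
  have hXW : X ⊆ W := hPp.subset hXP
  exact (g1Deriv_eq_g1 adj hL D (hXW.trans hW) (hcont X hXW) (hderiv X hXW)).symm

end PrintedActivities

end Literature.MathematicalPhysics.QuantumFieldTheory.BalabanImbrieJaffe1984to88.BIJ88PolymerRep5134Deriv

end
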